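import Literature.RepresentationTheory.FiniteGroups.PermutationReductionOrbitDecomposition
import Literature.RepresentationTheory.FiniteGroups.ArtinPermutationReductionTwist
import Literature.RepresentationTheory.FiniteGroups.StableLatticeReductionHom
import Mathlib.Algebra.MonoidAlgebra.Module
import Mathlib.Algebra.Group.Action.Sigma
import Mathlib.Data.Fintype.Option
import HarnessLib

/-!
# Reduction mod `p` of permutation lattices: invariance under isomorphism of `G`-sets, finite
# disjoint unions `ψ(ℤ[Σ i, X i]/p) = ∑ i ψ(ℤ[X i]/p)`, and the point term `ψ(M ⊗ ℤ[pt]/p) = ψ(M)`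

Topic `RepresentationTheory/FiniteGroups`; namespace `Literature.RepresentationTheory.FiniteGroups`
(sub-namespace `PermutationLattice`).  THEOREMS ONLY (no definition, no named fact, no `sorry`, no
instance).  Sequel of `PermutationReductionOrbitDecomposition` (`ψ(ℤ[X ⊔ Y]/p) = ψ(ℤ[X]/p) +
ψ(ℤ[Y]/p)`) and `ArtinPermutationReductionTwist` (Artin's induction theorem for a twisted additive
invariant); brick B3b-5 of the road memo `TATE-EPC-TC-ROAD` (evidence #54 on
stmt-BirchSwinnertonDyer-19032), the bookkeeping that turns Artin's identity of `G`-SETS into Milne's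
"it suffices to treat modules induced from cyclic subgroups" (ADT I Lemma 2.10, proof of Thm. 5.1).

`ψ`/`hψ` = the binder pair of `StableLatticeReductionInvariantInt` (universe `0`): an invariant of
`ℤ[G]`-modules with values in an abelian group `A`, additive on short exact sequences whose middle
term is finite and killed by `p`.  `ℤ[X] = Representation.ofMulAction ℤ G X` on `MonoidAlgebra ℤ X`.

* §1 `additive_reduction_ofMulAction_congr`: an equivariant bijection `X ≃ Y` gives
  `ψ(ℤ[X]/p) = ψ(ℤ[Y]/p)` (Mathlib `MonoidAlgebra.mapDomainLinearEquiv`);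
* §2 `additive_reduction_ofMulAction_sigma`: `ψ(ℤ[Σ i, X i]/p) = ∑ i, ψ(ℤ[X i]/p)` for a finite
  family of finite `G`-sets (`Fintype.induction_empty_option`);
* §3 `additive_tprod_reduction_quotient_top`: for a finite `M` killed by `p`,
  `ψ(M ⊗ ℤ[G/G]/p) = ψ(M)` (`M ≅ M ⊗_ℤ (ℤ[pt]/p)`, `m ↦ m ⊗ [pt]`);
* §4 `card_smul_add_sum_eq_sum`: Artin's identity unfolded —
  `|G|·ψ(M) + ∑ᵢ ψ(M ⊗ ℤ[G/H₁ i]/p) = ∑ⱼ ψ(M ⊗ ℤ[G/H₂ j]/p)` with all `H`'s CYCLIC.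

## References
* [SerreLinearRepresentations1977] J.-P. Serre, *Linear Representations of Finite Groups*, §12.5
  Thm. 26, §13.1 Thm. 30, §15.2 Thm. 32.
* [MilneADT2006] J. S. Milne, *Arithmetic Duality Theorems*, I Lemma 2.10, proof of Thm. 5.1.
-/

namespace Literature.RepresentationTheory.FiniteGroups

namespace PermutationLattice

open Function Submodule MonoidAlgebra StableLatticeReduction
open _root_.Representation _root_.LinearMap
open scoped Pointwise TensorProduct

variable {G : Type} [Group G] {A : Type*} [AddCommGroup A] {p : ℕ}

variable (ψ : ∀ ⦃Y : Type⦄ [AddCommGroup Y] [Module ℤ Y], Representation ℤ G Y → A)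
  (hψ : ∀ ⦃X Y Z : Type⦄ [AddCommGroup X] [Module ℤ X] [AddCommGroup Y] [Module ℤ Y]
    [AddCommGroup Z] [Module ℤ Z] (ρX : Representation ℤ G X) (ρY : Representation ℤ G Y)
    (ρZ : Representation ℤ G Z) (f : X →ₗ[ℤ] Y) (g : Y →ₗ[ℤ] Z),
    (∀ s x, f (ρX s x) = ρY s (f x)) → (∀ s y, g (ρY s y) = ρZ s (g y)) →
    Injective f → Surjective g → LinearMap.range f = LinearMap.ker g → Finite Y →
    (∀ y : Y, (p : ℤ) • y = 0) → ψ ρY = ψ ρX + ψ ρZ)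
include hψ

/-! ### §1. Invariance under an isomorphism of `G`-sets -/

/-- **An equivariant bijection `e : X ≃ Y` of finite `G`-sets gives `ψ(ℤ[X]/p) = ψ(ℤ[Y]/p)`**
(transport along `MonoidAlgebra.mapDomainLinearEquiv`). [cite: SerreLinearRepresentations1977, §15.2 Thm. 32] -/
theorem additive_reduction_ofMulAction_congr [hp : Fact p.Prime] {X Y : Type} [Fintype X] [Fintype Y]
    [MulAction G X] [MulAction G Y] (e : X ≃ Y) (he : ∀ (g : G) (x : X), e (g • x) = g • e x) :
    ψ ((Representation.ofMulAction ℤ G X).quotient ((p : ℤ) • ⊤) (smul_top_le_comap _ (p : ℤ))) =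
      ψ ((Representation.ofMulAction ℤ G Y).quotient ((p : ℤ) • ⊤) (smul_top_le_comap _ (p : ℤ))) := by
  haveI := finite_monoidAlgebra_quotient_smul_top (p := p) Y
  refine Int.additive_reduction_eq_of_linearEquiv ψ hψ _ _
    (MonoidAlgebra.mapDomainLinearEquiv ℤ ℤ e) (fun s f => ?_)
  induction f using MonoidAlgebra.induction_linear with
  | zero => simp only [map_zero]
  | add f g hf hg => simp only [map_add, hf, hg]
  | single x r =>
    rw [Representation.ofMulAction_single, mapDomainLinearEquiv_single, mapDomainLinearEquiv_single,
      Representation.ofMulAction_single, he]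

/-! ### §2. Finite disjoint unions -/

omit hψ in
/-- `Σ i : Option α, X i ≃ X none ⊔ Σ a, X (some a)` (plumbing for the induction). [folklore] -/
private theorem sigmaOption_aux {α : Type} (X : Option α → Type) [∀ i, MulAction G (X i)] :
    ∃ e : (Σ i : Option α, X i) ≃ X none ⊕ Σ a : α, X (some a),
      ∀ (g : G) (x : Σ i : Option α, X i), e (g • x) = g • e x := by
  refine ⟨{ toFun := fun s => match s with
              | ⟨none, x⟩ => Sum.inl x
              | ⟨some a, x⟩ => Sum.inr ⟨a, x⟩
            invFun := Sum.elim (fun x => ⟨none, x⟩) (fun s => ⟨some s.1, s.2⟩)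
            left_inv := by rintro ⟨_ | a, x⟩ <;> rfl
            right_inv := by rintro (x | ⟨a, x⟩) <;> rfl }, ?_⟩
  rintro g ⟨_ | a, x⟩
  · rfl
  · rfl

/-- `ψ` vanishes on the permutation lattice of an EMPTY `G`-set (a subsingleton module).
[cite: SerreLinearRepresentations1977, §15.2 Thm. 32] -/
theorem additive_reduction_ofMulAction_of_isEmpty [Fact p.Prime] {X : Type} [Fintype X]
    [IsEmpty X] [MulAction G X] :
    ψ ((Representation.ofMulAction ℤ G X).quotient ((p : ℤ) • ⊤) (smul_top_le_comap _ (p : ℤ))) = 0 := by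
  haveI : Subsingleton (MonoidAlgebra ℤ X) := ⟨fun a b => by
    apply MonoidAlgebra.coeff_injective; ext x; exact isEmptyElim x⟩
  haveI : Subsingleton (MonoidAlgebra ℤ X ⧸ ((p : ℤ) • ⊤ : Submodule ℤ (MonoidAlgebra ℤ X))) :=
    ⟨fun a b => by
      obtain ⟨x, rfl⟩ := mkQ_surjective _ a
      obtain ⟨y, rfl⟩ := mkQ_surjective _ b
      rw [Subsingleton.elim x y]⟩
  set ρ := (Representation.ofMulAction ℤ G X).quotient ((p : ℤ) • ⊤) (smul_top_le_comap _ (p : ℤ))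
  haveI : Finite (MonoidAlgebra ℤ X ⧸ ((p : ℤ) • ⊤ : Submodule ℤ (MonoidAlgebra ℤ X))) :=
    Finite.of_subsingleton
  have h := hψ ρ ρ ρ LinearMap.id LinearMap.id (fun _ _ => rfl) (fun _ _ => rfl) injective_id
    surjective_id (by rw [LinearMap.range_id, LinearMap.ker_id]; exact Subsingleton.elim _ _) ‹_›
    (fun y => Subsingleton.elim _ _)
  have h2 : ψ ρ + ψ ρ = ψ ρ + 0 := by rw [add_zero]; exact h.symm
  exact add_left_cancel h2

/-- **`ψ(ℤ[Σ i, X i]/p) = ∑ i, ψ(ℤ[X i]/p)`** for a finite family of finite `G`-sets (induction on the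
index type through `X none ⊔ Σ a, X (some a)`). [cite: SerreLinearRepresentations1977, §15.2 Thm. 32]
[cite: MilneADT2006, I Lemma 2.10] -/
theorem additive_reduction_ofMulAction_sigma [hp : Fact p.Prime] {ι : Type} [Fintype ι] (X : ι → Type)
    [∀ i, Fintype (X i)] [∀ i, MulAction G (X i)] :
    ψ ((Representation.ofMulAction ℤ G (Σ i, X i)).quotient ((p : ℤ) • ⊤)
        (smul_top_le_comap _ (p : ℤ))) =
      ∑ i, ψ ((Representation.ofMulAction ℤ G (X i)).quotient ((p : ℤ) • ⊤)
        (smul_top_le_comap _ (p : ℤ))) := by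
  classical
  revert X
  refine Fintype.induction_empty_option (P := fun (ι : Type) [Fintype ι] =>
    ∀ (X : ι → Type) [∀ i, Fintype (X i)] [∀ i, MulAction G (X i)],
      ψ ((Representation.ofMulAction ℤ G (Σ i, X i)).quotient ((p : ℤ) • ⊤)
        (smul_top_le_comap _ (p : ℤ))) =
      ∑ i, ψ ((Representation.ofMulAction ℤ G (X i)).quotient ((p : ℤ) • ⊤)
        (smul_top_le_comap _ (p : ℤ)))) ?_ ?_ ?_ ι
  · -- reindexing along `α ≃ β`
    intro α β _ e ih X _ _
    letI : Fintype α := Fintype.ofEquiv β e.symm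
    have h1 := ih (fun a => X (e a))
    rw [← Fintype.sum_equiv e (fun a => ψ ((Representation.ofMulAction ℤ G (X (e a))).quotient
        ((p : ℤ) • ⊤) (smul_top_le_comap _ (p : ℤ)))) _ (fun _ => rfl), ← h1]
    symm
    exact additive_reduction_ofMulAction_congr ψ hψ (Equiv.sigmaCongrLeft e)
      (by rintro g ⟨a, x⟩; rfl)
  · -- empty index type
    intro X _ _
    rw [Fintype.sum_empty]
    exact additive_reduction_ofMulAction_of_isEmpty ψ hψ
  · -- `Option α`
    intro α _ ih X _ _
    obtain ⟨e, he⟩ := sigmaOption_aux (G := G) X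
    rw [additive_reduction_ofMulAction_congr ψ hψ e he, additive_reduction_ofMulAction_sum ψ hψ,
      ih (fun a => X (some a)), Fintype.sum_option]

/-! ### §3. The point term `ψ(M ⊗ ℤ[G/G]/p) = ψ(M)` -/

/-- **`ψ(M ⊗ ℤ[pt]/p) = ψ(M)`** for a finite `ℤ[G]`-module `M` killed by `p`, `pt = G/G` the one-point
`G`-set: `m ↦ m ⊗ [pt]` is a `G`-isomorphism `M ≅ M ⊗_ℤ (ℤ[pt]/p)` (surjective since `ℤ[pt] = ℤ·pt`;
injective by the retraction `m ⊗ [f] ↦ f(pt)·m`, well defined as `pM = 0`).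
[cite: MilneADT2006, I Lemma 2.10 and proof of Thm. 5.1] [cite: SerreLinearRepresentations1977, §15.2 Thm. 32] -/
theorem additive_tprod_reduction_quotient_top [hp : Fact p.Prime] {M : Type} [AddCommGroup M] [Finite M]
    (ρM : Representation ℤ G M) (hM : ∀ m : M, (p : ℤ) • m = 0) :
    ψ (ρM.tprod ((Representation.ofMulAction ℤ G (G ⧸ (⊤ : Subgroup G))).quotient ((p : ℤ) • ⊤)
        (smul_top_le_comap _ (p : ℤ)))) = ψ ρM := by
  classical
  obtain ⟨good_sub, good_quot, hψ'⟩ := Int.admissible ψ hψ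
  haveI : Subsingleton (G ⧸ (⊤ : Subgroup G)) := QuotientGroup.subsingleton_quotient_top
  let pt : G ⧸ (⊤ : Subgroup G) := ((1 : G) : G ⧸ (⊤ : Subgroup G))
  let W : Submodule ℤ (MonoidAlgebra ℤ (G ⧸ (⊤ : Subgroup G))) := (p : ℤ) • ⊤
  let ρP := Representation.ofMulAction ℤ G (G ⧸ (⊤ : Subgroup G))
  let ρQ := ρP.quotient W (smul_top_le_comap _ (p : ℤ))
  -- `G` acts trivially on `ℤ[pt]` and on `ℤ[pt]/p`
  have hρP : ∀ (s : G) (f : MonoidAlgebra ℤ (G ⧸ (⊤ : Subgroup G))), ρP s f = f := by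
    intro s f
    induction f using MonoidAlgebra.induction_linear with
    | zero => rw [map_zero]
    | add f g hf hg => rw [map_add, hf, hg]
    | single x r => rw [Representation.ofMulAction_single, Subsingleton.elim (s • x) x]
  have hρQ : ∀ (s : G) (q : MonoidAlgebra ℤ (G ⧸ (⊤ : Subgroup G)) ⧸ W), ρQ s q = q := by
    intro s q
    obtain ⟨f, rfl⟩ := mkQ_surjective _ q
    change Submodule.Quotient.mk (ρP s f) = Submodule.Quotient.mk f
    rw [hρP]
  -- the coefficient at `pt`
  let c : MonoidAlgebra ℤ (G ⧸ (⊤ : Subgroup G)) →ₗ[ℤ] ℤ :=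
    (Finsupp.lapply pt) ∘ₗ (MonoidAlgebra.coeffLinearEquiv (S := ℤ) ℤ).toLinearMap
  have hc : ∀ f, c f = f.coeff pt := fun f => rfl
  have hΛ : ∀ f : MonoidAlgebra ℤ (G ⧸ (⊤ : Subgroup G)), f = (c f) • MonoidAlgebra.single pt 1 := by
    intro f
    apply MonoidAlgebra.coeff_injective
    ext x
    rw [Subsingleton.elim x pt, hc, MonoidAlgebra.coeff_smul, Finsupp.smul_apply,
      MonoidAlgebra.coeff_single, Finsupp.single_eq_same, smul_eq_mul, mul_one]
  -- the map `φ : m ↦ m ⊗ [pt]`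
  let q₀ : MonoidAlgebra ℤ (G ⧸ (⊤ : Subgroup G)) ⧸ W := Submodule.Quotient.mk (MonoidAlgebra.single pt 1)
  let φ : M →ₗ[ℤ] M ⊗[ℤ] (MonoidAlgebra ℤ (G ⧸ (⊤ : Subgroup G)) ⧸ W) :=
    (TensorProduct.mk ℤ M _).flip q₀
  have hφ : ∀ m, φ m = m ⊗ₜ q₀ := fun m => rfl
  -- the retraction `m ⊗ [f] ↦ f(pt) • m`
  let c' : MonoidAlgebra ℤ (G ⧸ (⊤ : Subgroup G)) →ₗ[ℤ] (M →ₗ[ℤ] M) :=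
    c.smulRight (LinearMap.id : M →ₗ[ℤ] M)
  have hc' : ∀ f m, c' f m = (c f) • m := fun f m => rfl
  have hker : W ≤ LinearMap.ker c' := by
    intro f hf
    obtain ⟨g, rfl⟩ := (Int.mem_smul_top_iff _ _).1 hf
    rw [LinearMap.mem_ker]
    refine LinearMap.ext fun m => ?_
    rw [hc', map_smul, smul_eq_mul, mul_comm, mul_smul, hM, smul_zero, LinearMap.zero_apply]
  let B : M →ₗ[ℤ] (MonoidAlgebra ℤ (G ⧸ (⊤ : Subgroup G)) ⧸ W) →ₗ[ℤ] M := (W.liftQ c' hker).flip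
  have hB : ∀ m f, B m (Submodule.Quotient.mk f) = (c f) • m := fun m f => rfl
  have hret : ∀ m, TensorProduct.lift B (φ m) = m := fun m => by
    rw [hφ, TensorProduct.lift.tmul, hB, hc, MonoidAlgebra.coeff_single, Finsupp.single_eq_same,
      one_smul]
  have hφbij : Function.Bijective φ := by
    constructor
    · exact fun a b hab => by rw [← hret a, ← hret b, hab]
    · intro t
      induction t using TensorProduct.induction_on with
      | zero => exact ⟨0, map_zero φ⟩
      | tmul m q =>
        obtain ⟨f, rfl⟩ := mkQ_surjective _ q
        refine ⟨(c f) • m, ?_⟩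
        have hq : (Submodule.Quotient.mk f : MonoidAlgebra ℤ (G ⧸ (⊤ : Subgroup G)) ⧸ W) = (c f) • q₀ := by
          conv_lhs => rw [hΛ f]
          rfl
        have h1 : (c f • m) ⊗ₜ[ℤ] q₀ = c f • (m ⊗ₜ[ℤ] q₀) :=
          ((TensorProduct.mk ℤ M (MonoidAlgebra ℤ (G ⧸ (⊤ : Subgroup G)) ⧸ W)).flip q₀).map_smul (c f) m
        have h2 : m ⊗ₜ[ℤ] (c f • q₀) = c f • (m ⊗ₜ[ℤ] q₀) :=
          (TensorProduct.mk ℤ M (MonoidAlgebra ℤ (G ⧸ (⊤ : Subgroup G)) ⧸ W) m).map_smul (c f) q₀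
        rw [hφ, mkQ_apply, hq, h1, h2]
      | add a b ha hb =>
        obtain ⟨x, rfl⟩ := ha
        obtain ⟨y, rfl⟩ := hb
        exact ⟨x + y, map_add φ x y⟩
  -- the tensor is finite and killed by `p`
  haveI : Finite (MonoidAlgebra ℤ (G ⧸ (⊤ : Subgroup G)) ⧸ W) :=
    finite_monoidAlgebra_quotient_smul_top (p := p) _
  have htors : ∀ y : M ⊗[ℤ] (MonoidAlgebra ℤ (G ⧸ (⊤ : Subgroup G)) ⧸ W), (p : ℤ) • y = 0 := by
    intro y
    induction y using TensorProduct.induction_on with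
    | zero => rw [smul_zero]
    | tmul m q => rw [TensorProduct.smul_tmul', hM, TensorProduct.zero_tmul]
    | add a b ha hb => rw [smul_add, ha, hb, add_zero]
  haveI : Finite (M ⊗[ℤ] (MonoidAlgebra ℤ (G ⧸ (⊤ : Subgroup G)) ⧸ W)) :=
    Module.finite_of_fg_torsion _ fun y =>
      ⟨⟨(p : ℤ), mem_nonZeroDivisors_of_ne_zero (by exact_mod_cast hp.out.ne_zero)⟩, htors y⟩
  symm
  refine Admissible.additive_eq_of_linearEquiv ψ _ good_quot hψ' ρM (ρM.tprod ρQ) ⟨‹_›, htors⟩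
    (LinearEquiv.ofBijective φ hφbij) (fun s m => ?_)
  change (ρM s m) ⊗ₜ[ℤ] q₀ = (ρM s m) ⊗ₜ[ℤ] (ρQ s q₀)
  rw [hρQ]

/-! ### §4. Artin's identity for a twisted additive invariant, unfolded along the orbits -/

/-- **Artin's induction theorem, unfolded**: for a finite group `G`, a finite `ℤ[G]`-module `M`
killed by `p` and an invariant `ψ` additive on finite `p`-torsion modules there are finite families
`H₁`, `H₂` of CYCLIC subgroups with
`|G| • ψ(M) + ∑ᵢ ψ(M ⊗ ℤ[G/H₁ i]/p) = ∑ⱼ ψ(M ⊗ ℤ[G/H₂ j]/p)` — the tree's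
`ArtinTwist.twist_reduction_artinSets_eq` (an identity between two permutation lattices) with the
disjoint unions split (§2) and the point terms evaluated (§3).  This is the form in which Milne's
"it suffices to prove the theorem for modules induced from cyclic subgroups" is consumed.
[cite: MilneADT2006, I Lemma 2.10 and proof of Thm. 5.1] [cite: SerreLinearRepresentations1977, §12.5 Thm. 26, §15.2 Thm. 32] -/
theorem card_smul_add_sum_eq_sum [Fintype G] [hp : Fact p.Prime] {M : Type} [AddCommGroup M]
    [Finite M] (ρM : Representation ℤ G M) (hM : ∀ m : M, (p : ℤ) • m = 0) :
    ∃ (ι₁ ι₂ : Type) (_ : Fintype ι₁) (_ : Fintype ι₂) (H₁ : ι₁ → Subgroup G)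
      (H₂ : ι₂ → Subgroup G), (∀ i, IsCyclic (H₁ i)) ∧ (∀ j, IsCyclic (H₂ j)) ∧
      Fintype.card G • ψ ρM +
          ∑ i, ψ (ρM.tprod ((Representation.ofMulAction ℤ G (G ⧸ H₁ i)).quotient ((p : ℤ) • ⊤)
            (smul_top_le_comap _ (p : ℤ)))) =
        ∑ j, ψ (ρM.tprod ((Representation.ofMulAction ℤ G (G ⧸ H₂ j)).quotient ((p : ℤ) • ⊤)
            (smul_top_le_comap _ (p : ℤ)))) := by
  classical
  obtain ⟨ι₁, ι₂, _, _, H₁, H₂, h₁, h₂, h⟩ := ArtinTwist.twist_reduction_artinSets_eq ψ hψ ρM hM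
  refine ⟨ι₁, ι₂, ‹_›, ‹_›, H₁, H₂, h₁, h₂, ?_⟩
  -- the twisted invariant `Y ↦ ψ (M ⊗ Y)` is again additive on finite `p`-torsion modules
  have hψ' := ArtinTwist.additive_twist ψ hψ ρM hM
  have hsum := additive_reduction_ofMulAction_sum (fun Y _ _ ρY => ψ (ρM.tprod ρY)) hψ'
    (Σ _ : Fin (Fintype.card G), G ⧸ (⊤ : Subgroup G)) (Σ i, G ⧸ H₁ i)
  have hsig₀ := additive_reduction_ofMulAction_sigma (fun Y _ _ ρY => ψ (ρM.tprod ρY)) hψ'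
    (fun _ : Fin (Fintype.card G) => G ⧸ (⊤ : Subgroup G))
  have hsig₁ := additive_reduction_ofMulAction_sigma (fun Y _ _ ρY => ψ (ρM.tprod ρY)) hψ'
    (fun i => G ⧸ H₁ i)
  have hsig₂ := additive_reduction_ofMulAction_sigma (fun Y _ _ ρY => ψ (ρM.tprod ρY)) hψ'
    (fun j => G ⧸ H₂ j)
  have hpt := additive_tprod_reduction_quotient_top ψ hψ ρM hM
  rw [hsum, hsig₀, hsig₁, hsig₂] at h
  simp only [hpt, Finset.sum_const, Finset.card_univ, Fintype.card_fin] at h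
  exact h

end PermutationLattice

end Literature.RepresentationTheory.FiniteGroups
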